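import Literature.NumberTheory.LFunctions.KeiperLiPositivityUpTo
import Literature.NumberTheory.LFunctions.SchoenfeldZeroSums
import Literature.NumberTheory.LFunctions.ZetaArgBacklundExplicit
import Literature.NumberTheory.LFunctions.TuringMethodTuringBound
import Literature.NumberTheory.LFunctions.RiemannSiegelThetaBounds
import Literature.NumberTheory.LFunctions.RiemannSiegelFacts
import Literature.NumberTheory.LFunctions.NymanBeurlingRate
import Literature.NumberTheory.LFunctions.NymanBeurlingProofs
import Literature.NumberTheory.LFunctions.ZetaZeros
import HarnessLib

/-!
# RiemannHypothesis / LiCoefficients — RH-FREE objects and typed targets of the ladder column LI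

Route `RiemannHypothesis/LiCoefficients` (human rulings D-0040 / D-0059 / D-0061; cell `pub/rh-li`,
theory seat gen 3, memos `theory/TARGETS.md` §8).  This `Defs` file fixes, for the record, the
vocabulary and the typed Prop targets of the column's two PROOF-OF-DATA rungs:

* PART A — L-P(P1), the **Li HEIGHT LAW** (RH-FREE): `LiHeightLaw c T₀`, the rung LEAF
  `LiHeightLawQuadratic = LiHeightLaw (1/5) (10^5)`, its crude / logarithmic variants, the
  Platt–Trudgian corollary `LiPositivityPlattTrudgian24` (`λ_n ≥ 0` for `n ≤ 1.8·10²⁴`, PROVED from the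
  leaf: `liPositivityPlattTrudgian24_of`), `liHeightLaw_of_log`, `LiHeightLaw.mono`, and the window
  weight's calculus.  The lemma targets L1–L6 / S1–S5 of the memo are the ITEMS of the route file
  `Theses/LiCoefficients.lean` (gate-written), whose deciding theorem `closes : LiBoxSplit →
  LiWindowLowerBound → LiFarZeroTail → LiHeightBudget → LiHeightLawQuadratic` is the memo's proved assembly.
* PART B — L-P(P2), the **structure of the Nyman–Beurling minimiser** (RH-FREE per `N`): the
  vocabulary (Gram matrices on `(0,∞)` and on Nyman's `(0,1)`, the conditional expectation `h` of
  `{1/x}` on the Farey partition, `Q = Var`, the dilate zero sums and their prime-side closed form, the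
  predicted `κ_∞`, the Levinson vector) and the rung LEAF `NbTailConstIdentity` (the exact identity
  `(1+Q)·tailConst(c⋆_N) = ⟨χ − f⋆, h⟩`); the other typed targets T1–T7 and the PROOF-OF-DATA laws stay in
  the memo / become items of the Nyman–Beurling route.

Everything here is a statement ABOUT tree objects (`keiperLiCoeff`, `RiemannHypothesisUpTo`,
`zerosBetween`, `zetaArgS`, `riemannSiegelThetaDeriv`, `baezDuarteDistSqOf`, `tailConst`, …); no
`sorry`; every `theorem` is proved here.  Nothing in this file bears on the truth of RH: the height
law turns a FINITE verified height into finitely many signs, and PART B is finite-`N` linear algebra.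
-/

noncomputable section

-- D-0017: `Summit.<S>.<S>.…` is the designed namespace of a single-problem summit.
set_option linter.dupNamespace false

/-! ## PART A — the Li HEIGHT LAW (condensed from the module docstring of HOME/theory/LiHeightLaw.lean;
the full memo is HOME/theory/TARGETS.md §8.1)

RH-FREE (tautology test, rh-columns-ref2 g8 PASS): the hypothesis is a FINITE verified height
`RiemannHypothesisUpTo T`, the conclusion is a sign of finitely many `λ_n`; no statement about the zeros
above `T` is assumed — they are controlled unconditionally (Backlund–Turing).

  `LiHeightLaw c T₀`:  for every `T ≥ T₀`, if every zero of `ζ` with `0 < Im ρ ≤ T` lies on the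
  critical line, then `λ_n = keiperLiCoeff n ≥ 0` for every `1 ≤ n ≤ c · T²`.

STATE OF THE ART.  The tree has the LINEAR range `n ≤ 2π(T − 4)`
(`keiperLiCoeff_nonneg_of_riemannHypothesisUpTo`, termwise positivity).  In print: F. Brown, JNT 111
(2005) Thm 2 asserts `n ≤ 2T² log T`, but its Lemma 5 has two errors (A. Droll, thesis Queen's 2012,
Conj. 1.7.10; A. Palojärvi, arXiv:1807.01506 §1: "Brown's Theorem 2 is left unproved"); J. Oesterlé's
range `n ≤ T²` (2000) is unpublished.  So a kernel proof of ANY quadratic range with an explicit constant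
is a new complete proof of a statement printed without one.  Converse direction: Brown's (valid) Thm 3.

PROOF ROUTE (all inputs PROVED tree theorems; the items of `Theses/LiCoefficients.lean`).  For `n ≥ 1`,
`λ_n = lim_{T'} Re Σ_{ρ ∈ box T'} m_ρ (1 − (1 − 1/ρ)ⁿ)` (`keiperLiCoeff_eq_zero_sum_holds`).  Fix `T ≥ T₀`
with `RiemannHypothesisUpTo T`, `n ≤ cT²`, window top `T₂ := min T (n/13)`, and split the box:
* `|Im ρ| ≤ T` (on the line): each term is `m(1 − cos(n θ(γ))) ≥ 0`, `θ = liZeroAngle`; keep only the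
  window `T₂/2 < |γ| ≤ T₂` (`LiBoxSplit`, with the far pairs below);
* `T < |Im ρ| ≤ T'`: pair `ρ ↔ 1 − ρ̄`; with `1 − 1/ρ = r e^{iφ}` the pair contributes
  `2 − (rⁿ + r⁻ⁿ) cos nφ ≥ −2(cosh(n log r) − 1) ≥ −2.82 n²/|ρ|⁴` (`n ≤ |ρ|²/4`);
* TAIL COUNT (`LiFarZeroTail`): `Σ_{T < γ ≤ U} m/γ⁴ ≤ log T/(6π T³)` (`U ≥ T ≥ 10³`), partial summation
  against `N(t) ≤ (t/2π) log(t/2πe) + 0.3083 log t + 4.128` (`abs_zetaZeroCount_sub_main_le_explicit`);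
* WINDOW SUM (`LiWindowLowerBound`, about zero ORDINATES only): `f = liWindowWeight n`, `a = T₂/2`,
  `b = T₂`; `Σ_{a<γ≤b} m f(γ) = [S f]_a^b + (1/π)∫_a^b ϑ' f − ∫_a^b S f'` (`N = ϑ/π + 1 + S`), then
  `abs_riemannSiegelThetaDeriv_sub_log_le`, one integration by parts of `∫ log(t/2π) cos nθ`,
  `abs_zetaArgS_le_explicit` (`|S| ≤ 0.3083 log t + 3.24`) and TURING `abs_integral_zetaArgS_le_turing_holds`
  (`|∫S| ≤ 2.30 + 0.128 log(b/2π)`, `a > 168π`) after a second integration by parts give `≥ liWindowBound n T₂`.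
  CRUDE VARIANT (no Turing, `sup|S|·∫|f'|`): the law with `c = 1/10`, `T₀ = 10⁶` (`LiHeightLawQuadraticCrude`);
* BUDGET (`LiHeightBudget`, a closed real inequality) and ASSEMBLY: `c = 1/5`, `T₀ = 10⁵`.  Method ceiling
  `c → 0.46`; the family's ceiling is `O(T²)` (for `n = cT² log T` the `S`-terms are `≍ c² T log³ T ≫ N(T)`);
  Brown's printed range (`LiHeightLawLog` of the memo) stays OPEN, outside this method.

COROLLARY at the Platt–Trudgian height `T = 3 000 175 332 800` (`riemannHypothesisUpTo_platt_trudgian`):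
`λ_n ≥ 0` for all `1 ≤ n ≤ 1.8 · 10²⁴` (`LiPositivityPlattTrudgian24`, glue PROVED below) — versus the
kernel's `1.885 · 10¹³` (`keiperLiCoeff_nonneg_of_plattTrudgian`) and the certified tables `n ≤ 10⁵`.

References: [BrownLiCriterion2005] F. Brown, JNT 111 (2005) 1–32, Thm 2/3, Lemma 5, Remark 1; A. Droll,
thesis (Queen's, 2012), Conj. 1.7.10, §3.2; [Palojarvi2020] A. Palojärvi, Alb. J. Math. 14 (2020) =
arXiv:1807.01506, §1; [PlattTrudgianBLMS2021]; Turing 1953 / Lehman 1970 (tree `TuringMethodTuringBound`).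
-/

section PartA

open Real Complex Finset MeasureTheory intervalIntegral
open scoped Real ComplexConjugate

namespace Summit.RiemannHypothesis.RiemannHypothesis.Theorems.LiTheory

open Literature.NumberTheory.LFunctions Literature.NumberTheory.LFunctions.SchoenfeldBound
open Literature.NumberTheory.DiophantineGeometry

/-! ## Vocabulary (same bodies as `theory/KeiperLiSplitTargetsV2.lean`) -/

/-- The zero angle `θ(t) = arg(1 − 1/(½ + it)) = 2 arctan(1/(2t))` (`t > 0`). -/
def liZeroAngle (t : ℝ) : ℝ :=
  2 * Real.arctan (1 / (2 * t))

/-- The window weight of the height law: `f_n(t) = 1 − cos(n θ(t)) ∈ [0, 2]`. -/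
def liWindowWeight (n : ℕ) (t : ℝ) : ℝ :=
  1 - Real.cos (n * liZeroAngle t)

/-- The explicit lower bound of the window sum `Σ_{T₂/2 < γ ≤ T₂} m f_n(γ)` delivered by the
Backlund–Turing budget (see the module docstring, item WINDOW SUM):
`(T₂/4π)(log(T₂/2π) − 0.31) − 0.36 (T₂²/n) log(T₂/2π) − 1.24 log T₂ − 14
 − (2.30 + 0.128 log(T₂/2π)) (4n/T₂² + (7/3) n²/T₂³)`. -/
def liWindowBound (n : ℕ) (T₂ : ℝ) : ℝ :=
  T₂ / (4 * π) * (Real.log (T₂ / (2 * π)) - 0.31) - 0.36 * (T₂ ^ 2 / n) * Real.log (T₂ / (2 * π))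
    - 1.24 * Real.log T₂ - 14
    - (2.30 + 0.128 * Real.log (T₂ / (2 * π))) * (4 * n / T₂ ^ 2 + 7 / 3 * n ^ 2 / T₂ ^ 3)

/-! ## The rung LEAF L-P(P1) and its corollary

The memo's family `LiHeightLaw c T₀ := ∀ T ≥ T₀, RiemannHypothesisUpTo T → ∀ 1 ≤ n ≤ cT², 0 ≤ λ_n`
is instantiated here (a Prop-valued family is not a tree object); `LiHeightLawLog` (Brown's printed
range `n ≤ cT² log T`, OPEN, outside this method family) stays in the memo. -/

/-- **LEAF L-P(P1) (RH-FREE; new in print as a complete proof): the Li HEIGHT LAW, quadratic range,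
`c = 1/5`, `T₀ = 10⁵`** — if every zero of `ζ` with `0 < Im ρ ≤ T` (`T ≥ 10⁵`) lies on the critical
line, then `λ_n = keiperLiCoeff n ≥ 0` for every `1 ≤ n ≤ T²/5`.  The hypothesis is a FINITE verified
height, the conclusion finitely many signs; the zeros above `T` are controlled unconditionally
(Backlund–Turing).  Route `Theses/LiCoefficients.lean`: `closes : LiBoxSplit → LiWindowLowerBound →
LiFarZeroTail → LiHeightBudget → LiHeightLawQuadratic`.  Brown 2005 Thm 2 (`n ≤ 2T² log T`) is printed
without a complete proof (Droll 2012 Conj. 1.7.10; Palojärvi 2020 §1); Oesterlé's `n ≤ T²` is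
unpublished. [folklore] -/
@[conjecture] def LiHeightLawQuadratic : Prop :=
  ∀ ⦃T : ℝ⦄, (10 : ℝ) ^ 5 ≤ T → RiemannHypothesisUpTo T →
    ∀ ⦃n : ℕ⦄, 1 ≤ n → (n : ℝ) ≤ 1 / 5 * T ^ 2 → 0 ≤ keiperLiCoeff n

/-- FIRST RUNG of the same law (cheaper: `sup |S|` only, no Turing bound): `c = 1/10`, `T₀ = 10⁶`.
[folklore] -/
@[conjecture] def LiHeightLawQuadraticCrude : Prop :=
  ∀ ⦃T : ℝ⦄, (10 : ℝ) ^ 6 ≤ T → RiemannHypothesisUpTo T →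
    ∀ ⦃n : ℕ⦄, 1 ≤ n → (n : ℝ) ≤ 1 / 10 * T ^ 2 → 0 ≤ keiperLiCoeff n

/-- The leaf implies its first rung. -/
theorem liHeightLawQuadraticCrude_of (h : LiHeightLawQuadratic) : LiHeightLawQuadraticCrude := by
  intro T hT hRH n hn hnc
  refine h (le_trans (by norm_num) hT) hRH hn (hnc.trans ?_)
  nlinarith [sq_nonneg T]

/-- **COROLLARY at the Platt–Trudgian height** (`riemannHypothesisUpTo_platt_trudgian`,
`T = 3 000 175 332 800`): `λ_n ≥ 0` for every `1 ≤ n ≤ 1.8·10²⁴` (`(1/5)·T² = 1.80021…·10²⁴`;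
the kernel's range today is `1.885·10¹³`, `keiperLiCoeff_nonneg_of_plattTrudgian`). [folklore] -/
@[conjecture] def LiPositivityPlattTrudgian24 : Prop :=
  riemannHypothesisUpTo_platt_trudgian →
    ∀ ⦃n : ℕ⦄, 1 ≤ n → n ≤ 1800000000000000000000000 → 0 ≤ keiperLiCoeff n

/-- Glue (PROVED): the leaf gives the Platt–Trudgian corollary. -/
theorem liPositivityPlattTrudgian24_of (h : LiHeightLawQuadratic) : LiPositivityPlattTrudgian24 := by
  intro hPT n hn hn'
  refine h (T := 3000175332800) (by norm_num) hPT hn ?_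
  have h' : (n : ℝ) ≤ 1800000000000000000000000 := by exact_mod_cast hn'
  refine h'.trans ?_
  norm_num

/-! ## Calculus of the window weight (PROVED; used by the route's L4 skeleton `Lines/backlund-turing.lean`) -/

/-- `f_n'(t) = n sin(nθ(t)) θ'(t)`, `θ'(t) = −4/(4t²+1)`. -/
def liWindowWeightDeriv (n : ℕ) (t : ℝ) : ℝ :=
  n * Real.sin (n * liZeroAngle t) * (-4 / (4 * t ^ 2 + 1))

/-- `θ'(t) = −4/(4t²+1)` for `t ≠ 0`. -/
theorem hasDerivAt_liZeroAngle {t : ℝ} (ht : t ≠ 0) :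
    HasDerivAt liZeroAngle (-4 / (4 * t ^ 2 + 1)) t := by
  have hd : HasDerivAt (fun y : ℝ ↦ 2 * y) (2 * 1) t := (hasDerivAt_id' t).const_mul 2
  have h1 := (hasDerivAt_const t (1 : ℝ)).div hd (by positivity)
  have h3 := (h1.arctan).const_mul (2 : ℝ)
  refine (h3.congr_of_eventuallyEq ?_).congr_deriv ?_
  · exact Filter.Eventually.of_forall fun y ↦ by simp [liZeroAngle]
  · have h4t : (4 : ℝ) * t ^ 2 + 1 ≠ 0 := by positivity
    have h2t : (2 : ℝ) * t ≠ 0 := by positivity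
    simp only [Pi.div_apply]
    field_simp
    ring

/-- `f_n' = liWindowWeightDeriv n` away from `t = 0`. -/
theorem hasDerivAt_liWindowWeight (n : ℕ) {t : ℝ} (ht : t ≠ 0) :
    HasDerivAt (liWindowWeight n) (liWindowWeightDeriv n t) t := by
  have h4 : HasDerivAt (fun t ↦ (n : ℝ) * liZeroAngle t) (n * (-4 / (4 * t ^ 2 + 1))) t :=
    (hasDerivAt_liZeroAngle ht).const_mul (n : ℝ)
  have h6 := h4.cos.const_sub (1 : ℝ)
  have h7 : HasDerivAt (liWindowWeight n)
      (-(-Real.sin (n * liZeroAngle t) * (n * (-4 / (4 * t ^ 2 + 1))))) t :=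
    h6.congr_of_eventuallyEq (Filter.Eventually.of_forall fun x ↦ rfl)
  convert h7 using 1
  simp only [liWindowWeightDeriv]
  ring

/-- `liWindowWeightDeriv n` is continuous on every `[a, b]` with `a > 0`. -/
theorem continuousOn_liWindowWeightDeriv (n : ℕ) {a b : ℝ} (ha : 0 < a) :
    ContinuousOn (liWindowWeightDeriv n) (Set.Icc a b) := by
  have hθ : ContinuousOn liZeroAngle (Set.Icc a b) := by
    have : ContinuousOn (fun t : ℝ ↦ 1 / (2 * t)) (Set.Icc a b) := by
      apply ContinuousOn.div continuousOn_const (continuousOn_const.mul continuousOn_id)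
      intro x hx
      have h2x : (0 : ℝ) < 2 * x := by linarith [hx.1]
      simpa using h2x.ne'
    exact continuousOn_const.mul (Real.continuous_arctan.comp_continuousOn this)
  have hsin : ContinuousOn (fun t : ℝ ↦ Real.sin (n * liZeroAngle t)) (Set.Icc a b) :=
    Real.continuous_sin.comp_continuousOn (continuousOn_const.mul hθ)
  have hfrac : ContinuousOn (fun t : ℝ ↦ (-4 : ℝ) / (4 * t ^ 2 + 1)) (Set.Icc a b) := by
    apply ContinuousOn.div continuousOn_const
    · exact (continuousOn_const.mul (continuousOn_id.pow 2)).add continuousOn_const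
    · intro x _; positivity
  exact (continuousOn_const.mul hsin).mul hfrac

end Summit.RiemannHypothesis.RiemannHypothesis.Theorems.LiTheory

end PartA

/-! ## PART B — NB head/tail structure and the κ-law (condensed from the module docstring of
HOME/theory/NBHeadTail.lean; the full memo with the kit results (j243603) is HOME/theory/TARGETS.md §8.2)

Conventions = HOME/DATA.md §B (tree `baezDuarteDistSqOf`): `H = L²((0,∞), dx)`, `χ = 1_{(0,1]}`,
`ρ_a(x) = {1/(ax)}` (`a = k+1`, `k : Fin N`), `G_{ab} = ⟨ρ_a, ρ_b⟩`, `b_a = ⟨χ, ρ_a⟩ = (log a + 1 − γ)/a`,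
minimiser `c⋆_N = G⁻¹b`, `d_N² = 1 − b·c⋆`, `tailConst c = Σ c_a/a` (`= ⟨f_c, ψ⟩`, `ψ := 1_{(1,∞)}/x`).

DATUM TO EXPLAIN (rh-li-eng, certified, RH-free per N): `κ_N := tailConst(c⋆_N)/d_N² = 0.3412 ± 0.0005`
for EVERY certified `20 ≤ N ≤ 2000` (whereas the Levinson/BCF vector has `tailConst·log N = −1.000`).

(T1) TAIL LEVERAGE: `d_N²(c) ≥ ‖χ − f_c‖²_{(0,1/2]} + (2 − 2log²2)·tailConst(c)²` for every `c`.
(T2) HEAD/TAIL = SHERMAN–MORRISON: `G = G⁰ + w wᵀ` (`G⁰` = Gram on `(0,1)`, `w_a = 1/a`), hence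
`tailConst(c⋆_N) = τ⁰_N/(1 + s_N)`, `d_N² = d⁰_N² + τ⁰_N²/(1+s_N)`, `s_N ≤ 1/(1 − 2log²2) = 25.6`.
(T3) THE TAIL-CONSTANT IDENTITY (the LEAF below).  Let `I_n = (1/(n+1), 1/n]`,
`m_n := n(n+1)log(1+1/n) − n` = the mean of `{1/x}` on `I_n`, `h := Σ_n m_n 1_{I_n}` (the conditional
expectation of `{1/x}` on the partition), `Q := ∫_0^1 ({1/x} − h)² = 0.0803270395…`.  KEY ORTHOGONALITY:
`⟨ρ_a, {1/x}·χ − h⟩ = Q/a` for every `a ≥ 1` (`ρ_a = ρ_1/a +` a step function on `{I_n}`, and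
`{1/x}χ − h ⊥` step functions).  Consequently, for every `N ≥ 1` and every solution of the normal equations,
      `(1 + Q) · tailConst(c⋆_N) = ⟨χ − f_{c⋆_N}, h⟩ = (1 − γ) − Σ_a c⋆_a ⟨ρ_a, h⟩`
(write `ρ_1 = ψ + h + q`, `q = {1/x}χ − h`; `⟨f⋆,ρ_1⟩ = ⟨χ,ρ_1⟩ = 1 − γ = ⟨χ,h⟩`, `⟨f⋆, q⟩ = Q·tailConst`).
Verified in floating point to `2·10⁻¹²` for all `N ≤ 2000` (kit j243603).
(T4) κ TO ZEROTH ORDER: `h = m_1 χ + h₂`, so `|(1+Q) tailConst(c⋆_N) − m_1 d_N²| ≤ d_N · dist(h₂, V_N)`;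
`κ ≈ m_1/(1+Q) = (2log2 − 1)/(1+Q) = 0.35757` (datum `0.3412`).
(L5) THE κ-LAW (PROOF-OF-DATA; limit form CONJECTURAL): with the dilate correlations `c_n(N)`,
`(1+Q)κ_N = m_1 + Σ_{n≥2}(m_n − m_{n−1}) c_n(N)` EXACTLY; the bilinear BDBLS heuristic predicts
`c_n(N) → S(n)/S(1)`, `S(n) := Σ_ρ n^{−ρ}/(ρ(1−ρ))`, i.e. `κ_N → κ_∞ = 0.3398` (prime-side closed form, T7).
(T6) LEVINSON IS FAR FROM OPTIMAL AT ACCESSIBLE N (RH-free, per N): for `v_N = (−μ(a)(1 − log a/log N))_a`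
(`nbLevinsonVector`; item `NbMoebiusMollifier` of route NymanBeurling), `tailConst(v_N) → −1/log N` and by (T1)
`‖χ − f_{v_N}‖² ≥ 1.039·tailConst(v_N)² ≈ 1.04/log²N`, which exceeds the optimum's `0.046/log N` while
`N < 6·10⁹` (measured `11×` the optimum at `N = 2000`).

References: Báez-Duarte 2003 (Rend. Lincei) §2; Báez-Duarte–Balazard–Landreau–Saias 2000 (BDBLS);
Landreau–Richard 2002 Thm 2.1 (Vasyunin's Gram formula, [Vasyunin1996]); Bettin–Conrey–Farmer 2013 Thm 1;
Burnol 2002 (tree `Burnol2002_thm1_3`).  Searches (theory NOTES.md): no printed source found for (T2)–(L5).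
-/

section PartB

open MeasureTheory Set Finset Filter
open scoped BigOperators Topology

namespace Summit.RiemannHypothesis.RiemannHypothesis.Theorems.NbTheory

open Literature.NumberTheory.LFunctions Literature.NumberTheory.LFunctions.BaezDuarteOnlyIf


/-! ## Vocabulary (same bodies as `theory/NBTargets.lean`, plus the gen-3 objects) -/

/-- `ρ_a(x) = {1/(ax)}` with `a = k+1`. -/
def nbRho (k : ℕ) (x : ℝ) : ℝ :=
  Int.fract (1 / (((k : ℝ) + 1) * x))

/-- Gram entry on `(0,∞)`. -/
def nbGram (j k : ℕ) : ℝ :=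
  ∫ x in Ioi (0 : ℝ), nbRho j x * nbRho k x

/-- Gram entry on `(0,1)` (NYMAN's interval): `G⁰_{jk}`. -/
def nbGram0 (j k : ℕ) : ℝ :=
  ∫ x in Ioc (0 : ℝ) 1, nbRho j x * nbRho k x

/-- `b_k = ⟨χ, ρ_{k+1}⟩`. -/
def nbRhs (k : ℕ) : ℝ :=
  ∫ x in Ioc (0 : ℝ) 1, nbRho k x

/-- The `N × N` Gram matrix `G = (⟨ρ_{j+1}, ρ_{k+1}⟩)` on `(0,∞)` (Báez-Duarte). -/
def nbGramMatrix (N : ℕ) : Matrix (Fin N) (Fin N) ℝ :=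
  Matrix.of fun j k ↦ nbGram j k

/-- The `N × N` Gram matrix `G⁰` on Nyman's interval `(0,1)`. -/
def nbGram0Matrix (N : ℕ) : Matrix (Fin N) (Fin N) ℝ :=
  Matrix.of fun j k ↦ nbGram0 j k

/-- The Báez-Duarte minimiser `c⋆_N = G⁻¹ b`. -/
def nbMinimiser (N : ℕ) : Fin N → ℝ :=
  (nbGramMatrix N)⁻¹.mulVec fun k ↦ nbRhs k

/-- The squared distance as a real number (the tree object is `ENNReal.ofReal` of a real integral,
`BaezDuarteOnlyIf.baezDuarteDistSqOf_eq_ofReal_integral`-style). -/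
def nbDistSq (N : ℕ) (c : Fin N → ℝ) : ℝ :=
  (baezDuarteDistSqOf N c).toReal

/-- `m_n` = mean of `{1/x}` on `I_n = (1/(n+1), 1/n]`: `n(n+1) log(1+1/n) − n` (`m_0 := 0`). -/
def nbFareyMean (n : ℕ) : ℝ :=
  if n = 0 then 0 else (n : ℝ) * (n + 1) * Real.log (1 + 1 / n) - n

/-- `h(x) = E[{1/x} | I_n] = m_{⌊1/x⌋}` on `(0,1]`, `0` elsewhere. -/
def nbStepH (x : ℝ) : ℝ :=
  if 0 < x ∧ x ≤ 1 then nbFareyMean ⌊1 / x⌋₊ else 0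

/-- `q(x) = {1/x} − h(x)` on `(0,1]` (mean zero on every `I_n`), `0` elsewhere. -/
def nbFluct (x : ℝ) : ℝ :=
  if 0 < x ∧ x ≤ 1 then Int.fract (1 / x) - nbStepH x else 0

/-- `Q = ‖q‖² = ∫_0^1 ({1/x} − h)² = 0.0803270395…`. -/
def nbQ : ℝ :=
  ∫ x in Ioc (0 : ℝ) 1, nbFluct x ^ 2

/-- `⟨ρ_{k+1}, h⟩`. -/
def nbRhoH (k : ℕ) : ℝ :=
  ∫ x in Ioc (0 : ℝ) 1, nbRho k x * nbStepH x

/-- `κ_N = tailConst(c⋆_N)/d_N²` (junk if `d_N = 0`, which never happens: `d_N² ≥ Burnol's bound`). -/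
def nbKappa (N : ℕ) : ℝ :=
  tailConst (nbMinimiser N) / nbDistSq N (nbMinimiser N)

/-- The Levinson / Bettin–Conrey–Farmer vector in NB coordinates: `v_a = −μ(a)(1 − log a/log N)`. -/
def nbLevinsonVector (N : ℕ) : Fin N → ℝ :=
  fun k ↦ -(ArithmeticFunction.moebius (k.val + 1) : ℝ) *
    (1 - Real.log ((k.val : ℝ) + 1) / Real.log N)

/-! ## (T1) Tail leverage -/

/-! ## (T2) Head/tail = Sherman–Morrison -/

/-! ## (T3) The tail-constant identity -/

/-- **RH-FREE, PROVABLE (M) — THE TAIL-CONSTANT IDENTITY.**  For every `N ≥ 1` and every solution of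
the normal equations `G c⋆ = b` (the minimiser):
`(1 + Q)·tailConst(c⋆) = (1 − γ) − Σ_k c⋆_k ⟨ρ_{k+1}, h⟩  ( = ⟨χ − f_{c⋆}, h⟩ )`. -/
@[conjecture] def NbTailConstIdentity : Prop :=
  ∀ (N : ℕ) (cs : Fin N → ℝ), 1 ≤ N →
    (∀ k : Fin N, ∑ j : Fin N, nbGram k j * cs j = nbRhs k) →
      (1 + nbQ) * tailConst cs =
        (1 - Real.eulerMascheroniConstant) - ∑ k : Fin N, cs k * nbRhoH k

/-! ## (T4) κ to zeroth order -/

/-- `h₂ = h − m_1 χ = Σ_{n≥2} (m_n − m_{n−1}) 1_{(0,1/n]}` (supported on `(0, 1/2]`). -/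
def nbStepH₂ (x : ℝ) : ℝ :=
  nbStepH x - nbFareyMean 1 * (Ioc (0 : ℝ) 1).indicator 1 x

/-! ## (L5) The κ-law -/

/-! ## (T7) The dilate zero sums in closed form (explicit formula; makes κ_∞ a PRIME-SIDE number) -/

/-- `S(n) := Σ_ρ m_ρ n^{−ρ}/(ρ(1−ρ))` over the non-trivial zeros (absolutely convergent; real by
`ρ ↦ ρ̄`; `= n^{−1/2} Σ_ρ m_ρ cos(γ log n)/|ρ|²` on RH).  `S(1) = Σ_ρ m_ρ/(ρ(1−ρ)) = 2 + γ − log 4π`. -/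
def nbDilateZeroSum (n : ℕ) : ℂ :=
  ∑' ρ : ZetaZeros.riemannZetaNontrivialZeros,
    (riemannZetaZeroOrder (ρ : ℂ) : ℂ) * (n : ℂ) ^ (-(ρ : ℂ)) / ((ρ : ℂ) * (1 - (ρ : ℂ)))

/-- The prime-side closed form of `S(n)`, `n ≥ 2`:
`(Σ_{m≤n} Λ(m)/m − log n + γ) − (ψ(n) − n)/n + (1 − log 2π)/n − (1/2n) log(1 − n⁻²) − ½ log((n+1)/(n−1))`
(each bracket `→ 0`: Mertens / PNT; so `S(n) → 0`). -/
def nbDilatePrimeSide (n : ℕ) : ℝ :=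
  ((∑ m ∈ Finset.range (n + 1), (ArithmeticFunction.vonMangoldt m : ℝ) / m) - Real.log n
      + Real.eulerMascheroniConstant)
    - ((∑ m ∈ Finset.range (n + 1), (ArithmeticFunction.vonMangoldt m : ℝ)) - n) / n
    + (1 - Real.log (2 * Real.pi)) / n - 1 / (2 * n) * Real.log (1 - 1 / (n : ℝ) ^ 2)
    - 1 / 2 * Real.log (((n : ℝ) + 1) / ((n : ℝ) - 1))

/-- The predicted limit of `κ_N` under the bilinear BDBLS heuristic, as a PRIME-SIDE series (no zeros):
`κ_∞ = [m_1 + Σ_{n≥2} (m_n − m_{n−1}) S(n)/S(1)]/(1+Q)` with `S` in closed form; value `0.33981`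
(folder/kappa_closed.py, `n ≤ 2·10⁵`; 500-zero evaluation `0.34004`). -/
def nbKappaPredicted : ℝ :=
  (nbFareyMean 1 + ∑' n : ℕ, (nbFareyMean (n + 2) - nbFareyMean (n + 1)) *
      (nbDilatePrimeSide (n + 2) / (2 + Real.eulerMascheroniConstant - Real.log (4 * Real.pi)))) /
    (1 + nbQ)

/-! ## (T6) The Levinson vector -/

/-! ## Sanity: the zeroth-order constant -/

example : nbFareyMean 0 = 0 := by simp [nbFareyMean]


end Summit.RiemannHypothesis.RiemannHypothesis.Theorems.NbTheory

end PartB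

end
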